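import Mathlib
import Summits.CriticalPhenomena.CardyFormulaZ2.Theorems.CardySelfRefinementDefs
import Summits.CriticalPhenomena.CardyFormulaZ2.Theorems.CardySelfRefinementRussoDriftModel
import Summits.CriticalPhenomena.CardyFormulaZ2.Theorems.CardySelfRefinementGradientComparabilityStubCornerHWBRhoLeg
import Literature.Probability.Percolation.SeedLemma
import Literature.Probability.LatticeModels.MedialPerturbation
import HarnessLib

/-!
# Crux `GradientComparability` (stmt-CriticalPhenomena-10269), line `monotone-product-coordinates` —
# stub `stub_cornerHardWayBoxes` (HWB), brick (ii-c), part 1: rerouting an open crossing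

Route `CardySelfRefinement`; vocabulary from `CardySelfRefinementDefs` (`ax tb opn cfg edgeOf dirVec`),
bundle read-out facts from `…StubCornerHWBRhoLeg` (`opn_congr_off_selector_shared`,
`cfg_subset_cfg_of_opn`).

Brick (ii-c) of the revised route to (HWB) is the Aizenman–Grimmett interior-bypass inequality
`∂pF ≤ L ∂cF` for the three-parameter family `M_k(ρ, c; p)` and a box-crossing event: a pivotal
SHARED coin of a bundle is converted, by closing it and opening the interior ("own") coins of the
`3 × (k + 3)` lattice strip around the bundle, into a pivotal INTERIOR coin nearby, at bounded cost.
This file is the deterministic graph part, in two layers.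

* `openCrossing_reroute` (abstract, any vertex type; registered for `ℤ²` as
  `openCrossing_reroute_site`): if `ω` crosses `R` from `A` to `B`, every edge of `ω` off a danger
  zone `D` survives in `ω' ⊆ ω''`, neighbours of bad danger vertices are good, good vertices of `R`
  are `ω''`-joined inside `R`, and bad danger vertices of `A`/`B` have good substitutes, then `ω''`
  crosses.  Proof: propagate along the open walk the invariant "off `D ∪ C`: joined to `A`; on
  `D ∪ C`: some good vertex of `R` is joined to `A`".
* the `ℤ²` toolkit for the strip `N = [kt_d - 1, kt_d + k + 1] × [kt_{d'} - 1, kt_{d'} + 1]` of the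
  bundle `(t, d)`: coordinates of lattice steps, the interior strip edges `Ω` as a bond configuration,
  straight interior runs inside a box-closed `R` (`strip_run`), and the read-out facts "closing the
  shared coin closes only sub-edges" (`mem_cfg_sdiff_shared`), "own coins only open edges"
  (`cfg_mono_of_own`).
Part 2 (`…StubCornerHWBBypassGeom`) proves the connectivity of the good part of the strip and
assembles the surgery `bypass_openCrossing`.  (Aizenman–Grimmett 1991; Grimmett 1999 §3.3.)
-/

noncomputable section

namespace Summit.CriticalPhenomena.CardyFormulaZ2.Theorems.CardySelfRefinement

open scoped Topology
open Filter Set MeasureTheory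
open Literature.Probability.LatticeModels Literature.Probability.Percolation
open Literature.Probability.Percolation.QuadCrossing
open Summit.CriticalPhenomena.CardyFormulaZ2.Theses.CardySelfRefinement

/-! ## Rerouting an open crossing through a bypass (abstract graph lemma) -/

/-- An open edge with both endpoints in `S` joins them inside `S` (local copy). -/
theorem reroute_adj {V : Type*} {S : Set V} {x y : V} {ω : BondConfig V} (hx : x ∈ S) (hy : y ∈ S)
    (he : s(x, y) ∈ ω) (hne : x ≠ y) : ω ∈ openConnIn S x y :=
  ⟨hx, hy, SimpleGraph.Adj.reachable (show ((openGraph ω).induce S).Adj ⟨x, hx⟩ ⟨y, hy⟩ from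
    (openGraph_adj ω x y).2 ⟨he, hne⟩)⟩

/-- **Rerouting lemma.**  Let `ω` realise an open crossing of `R` from `A` to `B`.  Suppose every
edge of `ω` with an endpoint off the "danger zone" `D` survives in `ω' ⊆ ω''`, every
`ω`-neighbour of a vertex of `D` outside the "good set" `C` is good, any two good vertices of `R`
are joined by `ω''` inside `R`, and a bad danger vertex of `A ∩ R` (resp. `B ∩ R`) has a good
substitute in `A ∩ R` (resp. `B ∩ R`).  Then `ω''` realises the crossing. -/
theorem openCrossing_reroute {V : Type*} {R A B D C : Set V} {ω ω' ω'' : BondConfig V}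
    (hω : ω ∈ openCrossing R A B)
    (h2 : ∀ x y, s(x, y) ∈ ω → (x ∉ D ∨ y ∉ D) → s(x, y) ∈ ω')
    (h3 : ∀ x ∈ D, x ∉ C → ∀ y, s(x, y) ∈ ω → y ≠ x → y ∈ C)
    (h4 : ∀ a ∈ C ∩ R, ∀ a' ∈ C ∩ R, ω'' ∈ openConnIn R a a')
    (h5 : ω' ⊆ ω'')
    (h6A : ∀ x ∈ D ∩ R, x ∈ A → x ∉ C → ∃ a ∈ C ∩ R, a ∈ A)
    (h6B : ∀ x ∈ D ∩ R, x ∈ B → x ∉ C → ∃ a ∈ C ∩ R, a ∈ B) :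
    ω'' ∈ openCrossing R A B := by
  classical
  obtain ⟨x, hxA, y, hyB, hxR, hyR, hreach⟩ := hω
  obtain ⟨p⟩ := hreach
  -- the invariant propagated along the walk
  set Reach : V → Prop := fun z => ∃ x' ∈ A, ω'' ∈ openConnIn R x' z with hReach
  set ReachC : Prop := ∃ x' ∈ A, ∃ a ∈ C ∩ R, ω'' ∈ openConnIn R x' a with hReachC
  set I : V → Prop := fun z => (z ∉ D ∪ C → Reach z) ∧ (z ∈ D ∪ C → ReachC) with hI
  have hCR : ∀ z ∈ C ∩ R, ReachC → Reach z := fun z hz ⟨x', hx', a, ha, h⟩ =>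
    ⟨x', hx', GM.openConnIn_trans h (h4 a ha z hz)⟩
  have step : ∀ z z' : V, z ∈ R → z' ∈ R → s(z, z') ∈ ω → z ≠ z' → I z → I z' := by
    intro z z' hz hz' he hne hIz
    have hsurv : z ∉ D → ω'' ∈ openConnIn R z z' := fun hzD =>
      reroute_adj hz hz' (h5 (h2 z z' he (Or.inl hzD))) hne
    have hsurv' : z' ∉ D → ω'' ∈ openConnIn R z z' := fun hzD =>
      reroute_adj hz hz' (h5 (h2 z z' he (Or.inr hzD))) hne
    refine ⟨fun hz'DC => ?_, fun hz'DC => ?_⟩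
    · -- `z'` is neither dangerous nor good
      have hz'D : z' ∉ D := fun h => hz'DC (Or.inl h)
      by_cases hzDC : z ∈ D ∪ C
      · by_cases hzC : z ∈ C
        · obtain ⟨x', hx', h⟩ := hCR z ⟨hzC, hz⟩ (hIz.2 hzDC)
          exact ⟨x', hx', GM.openConnIn_trans h (hsurv' hz'D)⟩
        · have hzD : z ∈ D := hzDC.resolve_right hzC
          exact absurd (Or.inr (h3 z hzD hzC z' he hne.symm)) hz'DC
      · obtain ⟨x', hx', h⟩ := hIz.1 hzDC
        exact ⟨x', hx', GM.openConnIn_trans h (hsurv' hz'D)⟩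
    · by_cases hzDC : z ∈ D ∪ C
      · exact hIz.2 hzDC
      · have hzD : z ∉ D := fun h => hzDC (Or.inl h)
        have hzC : z ∉ C := fun h => hzDC (Or.inr h)
        obtain ⟨x', hx', h⟩ := hIz.1 hzDC
        rcases hz'DC with hz'D | hz'C
        · by_cases hz'C : z' ∈ C
          · exact ⟨x', hx', z', ⟨hz'C, hz'⟩, GM.openConnIn_trans h (hsurv hzD)⟩
          · have he' : s(z', z) ∈ ω := by rwa [Sym2.eq_swap]
            exact absurd (h3 z' hz'D hz'C z he' hne) hzC
        · exact ⟨x', hx', z', ⟨hz'C, hz'⟩, GM.openConnIn_trans h (hsurv hzD)⟩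
  -- propagate along the walk
  have key : ∀ (u v : R) (q : ((openGraph ω).induce R).Walk u v), I u → I v := by
    intro u v q
    induction q with
    | nil => exact id
    | cons hadj q ih =>
      rename_i u₀ u₁ _
      intro hu
      refine ih (step u₀ u₁ u₀.2 u₁.2 ?_ ?_ hu)
      · exact ((openGraph_adj ω _ _).1 (SimpleGraph.induce_adj.1 hadj)).1
      · exact ((openGraph_adj ω _ _).1 (SimpleGraph.induce_adj.1 hadj)).2
  have hIx : I x := by
    refine ⟨fun _ => ⟨x, hxA, ⟨hxR, hxR, SimpleGraph.Reachable.refl _⟩⟩, fun hxDC => ?_⟩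
    by_cases hxC : x ∈ C
    · exact ⟨x, hxA, x, ⟨hxC, hxR⟩, ⟨hxR, hxR, SimpleGraph.Reachable.refl _⟩⟩
    · obtain ⟨a, ha, haA⟩ := h6A x ⟨hxDC.resolve_right hxC, hxR⟩ hxA hxC
      exact ⟨a, haA, a, ha, ⟨ha.2, ha.2, SimpleGraph.Reachable.refl _⟩⟩
  have hIy : I y := key ⟨x, hxR⟩ ⟨y, hyR⟩ p hIx
  by_cases hyDC : y ∈ D ∪ C
  · have hRC := hIy.2 hyDC
    by_cases hyC : y ∈ C
    · obtain ⟨x', hx', h⟩ := hCR y ⟨hyC, hyR⟩ hRC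
      exact ⟨x', hx', y, hyB, h⟩
    · obtain ⟨b', hb', hb'B⟩ := h6B y ⟨hyDC.resolve_right hyC, hyR⟩ hyB hyC
      obtain ⟨x', hx', h⟩ := hCR b' hb' hRC
      exact ⟨x', hx', b', hb'B, h⟩
  · obtain ⟨x', hx', h⟩ := hIy.1 hyDC
    exact ⟨x', hx', y, hyB, h⟩

/-! ## Read-out facts for the surgery -/

/-- Adding own coins (layer `0`) to a coin sample can only open edges. -/
theorem cfg_mono_of_own (k : ℕ) {T T' : Set (Site 2 × Fin 2 × Fin 3)} (hTT' : T ⊆ T')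
    (h12 : ∀ x ∈ T', x.2.2 ≠ 0 → x ∈ T) : cfg k T ⊆ cfg k T' := by
  refine cfg_subset_cfg_of_opn k fun vd hopn => ?_
  obtain ⟨v, e⟩ := vd
  by_cases hax : ax k (v, e)
  · simp only [opn, if_pos hax] at hopn ⊢
    rcases hopn with ⟨h2, h1⟩ | ⟨h2, h0⟩
    · exact Or.inl ⟨hTT' h2, hTT' h1⟩
    · exact Or.inr ⟨fun h => h2 (h12 _ h (by simp)), hTT' h0⟩
  · simp only [opn, if_neg hax] at hopn ⊢
    exact hTT' hopn

/-- Closing the shared coin of the bundle `(t, d)` closes only sub-edges of the bundle. -/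
theorem mem_cfg_sdiff_shared (k : ℕ) (t : Site 2) (d : Fin 2) (S : Set (Site 2 × Fin 2 × Fin 3))
    {x y : Site 2} (he : s(x, y) ∈ cfg k (insert (t, d, (1 : Fin 3)) S))
    (hxy : ¬ ∃ v : Site 2, (ax k (v, d) ∧ tb k (v, d) = t) ∧ s(x, y) = s(v, v + dirVec d)) :
    s(x, y) ∈ cfg k (S \ {(t, d, (1 : Fin 3))}) := by
  obtain ⟨v, e, hxy', hopn⟩ := he
  refine ⟨v, e, hxy', ?_⟩
  have hb : ¬ (ax k (v, e) ∧ tb k (v, e) = t ∧ (v, e).2 = d) := by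
    rintro ⟨hax, htb, h⟩
    dsimp only at h
    subst h
    exact hxy ⟨v, ⟨hax, htb⟩, hxy'⟩
  refine (opn_congr_off_selector_shared k (T := insert (t, d, (1 : Fin 3)) S)
    (T' := S \ {(t, d, (1 : Fin 3))}) (fun z _ hz1 => ?_) hb).1 hopn
  simp [hz1]

/-- Edges of a read-out are unit steps of `ℤ²`. -/
theorem exists_dirVec_of_mem_cfg (k : ℕ) {T : Set (Site 2 × Fin 2 × Fin 3)} {x y : Site 2}
    (h : s(x, y) ∈ cfg k T) : ∃ e : Fin 2, y = x + dirVec e ∨ x = y + dirVec e := by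
  obtain ⟨v, e, hxy, -⟩ := h
  refine ⟨e, ?_⟩
  rcases Sym2.eq_iff.1 hxy with ⟨rfl, rfl⟩ | ⟨rfl, rfl⟩
  · exact Or.inl rfl
  · exact Or.inr rfl

/-- A non-axial edge whose own coin is on is open. -/
theorem edgeOf_mem_cfg_of_not_ax (k : ℕ) {T : Set (Site 2 × Fin 2 × Fin 3)} {g : Site 2 × Fin 2}
    (hax : ¬ ax k g) (hg : (g.1, g.2, (0 : Fin 3)) ∈ T) : edgeOf g ∈ cfg k T := by
  obtain ⟨v, e⟩ := g
  refine ⟨v, e, rfl, ?_⟩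
  simp only [opn, if_neg hax]
  exact hg

/-! ## Lattice geometry of the bypass strip -/

/-- The other index of `Fin 2`. -/
theorem acr_eq {d d' : Fin 2} (hd : d' ≠ d) : (if d = 0 then (1 : Fin 2) else 0) = d' := by
  revert d d'; decide

/-- Points of `ℤ²` are determined by their two coordinates. -/
theorem site_eq_iff_of_ne {d d' : Fin 2} (hd : d' ≠ d) {v w : Site 2} : v = w ↔ v d = w d ∧ v d' = w d' := by
  refine ⟨fun h => by simp [h], fun h => funext fun j => ?_⟩
  rcases fin_two_cases_of_ne hd j with rfl | rfl
  · exact h.1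
  · exact h.2

/-- Coordinates of a translate along a lattice direction. -/
theorem add_smul_dirVec_apply (v : Site 2) (m : ℤ) (δ j : Fin 2) :
    (v + m • dirVec δ) j = v j + if j = δ then m else 0 := by
  simp only [Pi.add_apply, Pi.smul_apply, smul_eq_mul]
  rw [show (dirVec δ : Site 2) = Pi.single δ 1 from dirVec_eq_single δ, Pi.single_apply]
  split_ifs <;> simp

/-- Coordinates of a unit step. -/
theorem add_dirVec_apply (v : Site 2) (δ j : Fin 2) :
    (v + dirVec δ) j = v j + if j = δ then 1 else 0 := by
  simpa using add_smul_dirVec_apply v 1 δ j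

/-- Axiality of the edge `(v, δ)` reads the coordinate across `δ`. -/
theorem ax_iff_dvd {k : ℕ} {δ δ' : Fin 2} (hδ : δ' ≠ δ) (v : Site 2) : ax k (v, δ) ↔ (k : ℤ) ∣ v δ' := by
  show (k : ℤ) ∣ v (if δ = 0 then 1 else 0) ↔ _
  rw [acr_eq hδ]

/-- The strip `N` of the bundle `(t, d)` (local notation): the `ℓ∞`-`1`-neighbourhood of its vertex
set, `[kt_d - 1, kt_d + k + 1]` along `d` times `[kt_{d'} - 1, kt_{d'} + 1]` across. -/
local notation3 (prettyPrint := false) "inN(" k ", " t ", " d ", " v ")" =>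
  (∀ j : Fin 2, (k : ℤ) * t j - 1 ≤ (v : Site 2) j ∧ (v : Site 2) j ≤ (k : ℤ) * t j + (if j = d then (k : ℤ) + 1 else 1))

/-- The interior (non-axial) edges of the strip, as a bond configuration (local notation). -/
local notation3 (prettyPrint := false) "Ω(" k ", " t ", " d ")" =>
  {e : Sym2 (Site 2) | ∃ g : Site 2 × Fin 2, e = edgeOf g ∧ ¬ ax k g ∧ inN(k, t, d, g.1) ∧ inN(k, t, d, g.1 + dirVec g.2)}

/-- Box-closed vertex sets (local notation): with two points, `R` contains the lattice box they span. -/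
local notation3 (prettyPrint := false) "BoxClosed(" R ")" =>
  (∀ u ∈ (R : Set (Site 2)), ∀ w ∈ R, ∀ v : Site 2, (∀ j : Fin 2, min (u j) (w j) ≤ v j ∧ v j ≤ max (u j) (w j)) → v ∈ R)

/-- The strip in the two coordinates. -/
theorem inN_iff {k : ℕ} {t : Site 2} {d d' : Fin 2} (hd : d' ≠ d) (v : Site 2) :
    inN(k, t, d, v) ↔ ((k : ℤ) * t d - 1 ≤ v d ∧ v d ≤ (k : ℤ) * t d + (k : ℤ) + 1) ∧
      ((k : ℤ) * t d' - 1 ≤ v d' ∧ v d' ≤ (k : ℤ) * t d' + 1) := by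
  constructor
  · intro h
    have h1 := h d
    have h2 := h d'
    rw [if_pos rfl] at h1
    rw [if_neg hd] at h2
    exact ⟨⟨h1.1, by linarith [h1.2]⟩, h2⟩
  · rintro ⟨h1, h2⟩ j
    rcases fin_two_cases_of_ne hd j with rfl | rfl
    · rw [if_pos rfl]; exact ⟨h1.1, by linarith [h1.2]⟩
    · rw [if_neg hd]; exact h2

/-- The strip is box-closed. -/
theorem inN_between {k : ℕ} {t : Site 2} {d : Fin 2} {u w v : Site 2} (hu : inN(k, t, d, u))
    (hw : inN(k, t, d, w)) (h : ∀ j : Fin 2, min (u j) (w j) ≤ v j ∧ v j ≤ max (u j) (w j)) :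
    inN(k, t, d, v) := fun j =>
  ⟨(le_min (hu j).1 (hw j).1).trans (h j).1, (h j).2.trans (max_le (hu j).2 (hw j).2)⟩

/-- One interior step of the strip inside `R`. -/
theorem strip_adj_step {k : ℕ} {t : Site 2} {d : Fin 2} {R : Set (Site 2)} {v : Site 2} {δ : Fin 2}
    (hax : ¬ ax k (v, δ)) (hv : inN(k, t, d, v)) (hv' : inN(k, t, d, v + dirVec δ)) (hR : v ∈ R)
    (hR' : v + dirVec δ ∈ R) : Ω(k, t, d) ∈ openConnIn R v (v + dirVec δ) := by
  refine reroute_adj hR hR' ⟨(v, δ), rfl, hax, hv, hv'⟩ fun h => ?_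
  have := congrFun h δ
  rw [add_dirVec_apply, if_pos rfl] at this
  linarith

/-- A straight interior run of the strip inside a box-closed `R` (natural length). -/
theorem strip_run_nat {k : ℕ} {t : Site 2} {d : Fin 2} {R : Set (Site 2)} (hRc : BoxClosed(R))
    {δ δ' : Fin 2} (hδ : δ' ≠ δ) :
    ∀ (m : ℕ) (v : Site 2), ¬ (k : ℤ) ∣ v δ' → inN(k, t, d, v) → v ∈ R →
      inN(k, t, d, v + (m : ℤ) • dirVec δ) → v + (m : ℤ) • dirVec δ ∈ R →
      Ω(k, t, d) ∈ openConnIn R v (v + (m : ℤ) • dirVec δ) := by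
  intro m
  induction m with
  | zero =>
    intro v _ _ hR _ _
    have h0 : v + ((0 : ℕ) : ℤ) • dirVec δ = v := by simp
    rw [h0]
    exact ⟨hR, hR, SimpleGraph.Reachable.refl _⟩
  | succ m ih =>
    intro v hv hN hR hN' hR'
    have hbet : ∀ j : Fin 2, min (v j) ((v + ((m + 1 : ℕ) : ℤ) • dirVec δ) j) ≤ (v + (m : ℤ) • dirVec δ) j ∧
        (v + (m : ℤ) • dirVec δ) j ≤ max (v j) ((v + ((m + 1 : ℕ) : ℤ) • dirVec δ) j) := by
      intro j
      rw [add_smul_dirVec_apply, add_smul_dirVec_apply]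
      push_cast
      split_ifs
      · constructor
        · exact (min_le_left _ _).trans (by linarith)
        · exact le_trans (by linarith) (le_max_right _ _)
      · simp
    have hwN : inN(k, t, d, v + (m : ℤ) • dirVec δ) := inN_between hN hN' hbet
    have hwR : v + (m : ℤ) • dirVec δ ∈ R := hRc v hR _ hR' _ hbet
    have h1 := ih v hv hN hR hwN hwR
    have heq : v + ((m + 1 : ℕ) : ℤ) • dirVec δ = v + (m : ℤ) • dirVec δ + dirVec δ := by
      push_cast
      rw [add_smul, one_smul, add_assoc]
    rw [heq] at hN' hR' ⊢
    refine GM.openConnIn_trans h1 (strip_adj_step ?_ hwN hN' hwR hR')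
    rw [ax_iff_dvd hδ, add_smul_dirVec_apply, if_neg hδ, add_zero]
    exact hv

/-- A straight interior run of the strip inside a box-closed `R` (integer displacement). -/
theorem strip_run {k : ℕ} {t : Site 2} {d : Fin 2} {R : Set (Site 2)} (hRc : BoxClosed(R))
    {δ δ' : Fin 2} (hδ : δ' ≠ δ) (m : ℤ) (v : Site 2) (hv : ¬ (k : ℤ) ∣ v δ') (hN : inN(k, t, d, v))
    (hR : v ∈ R) (hN' : inN(k, t, d, v + m • dirVec δ)) (hR' : v + m • dirVec δ ∈ R) :
    Ω(k, t, d) ∈ openConnIn R v (v + m • dirVec δ) := by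
  obtain ⟨n, rfl | rfl⟩ := Int.eq_nat_or_neg m
  · exact strip_run_nat hRc hδ n v hv hN hR hN' hR'
  · have heq : v = v + -(n : ℤ) • dirVec δ + (n : ℤ) • dirVec δ := by
      rw [add_assoc, neg_smul, neg_add_cancel, add_zero]
    have hv' : ¬ (k : ℤ) ∣ (v + -(n : ℤ) • dirVec δ) δ' := by
      rw [add_smul_dirVec_apply, if_neg hδ, add_zero]; exact hv
    have h := strip_run_nat hRc hδ n (v + -(n : ℤ) • dirVec δ) hv' hN' hR' (heq ▸ hN) (heq ▸ hR)
    rw [← heq] at h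
    obtain ⟨h1, h2, h3⟩ := h
    exact ⟨h2, h1, h3.symm⟩

/-- Coordinates of a backward unit step. -/
theorem sub_dirVec_apply (v : Site 2) (δ j : Fin 2) :
    (v - dirVec δ) j = v j - if j = δ then 1 else 0 := by
  have := add_smul_dirVec_apply v (-1) δ j
  rw [neg_one_smul, ← sub_eq_add_neg] at this
  rw [this]
  split_ifs <;> ring

/-! ### Arithmetic of the coarse lattice for `k = 2, 3` -/

/-- Off the coarse row of the strip no coordinate is a multiple of `k`. -/
theorem not_dvd_of_offrow {k : ℕ} (hk : k = 2 ∨ k = 3) {c y : ℤ} (h1 : (k : ℤ) * c - 1 ≤ y)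
    (h2 : y ≤ (k : ℤ) * c + 1) (h3 : y ≠ (k : ℤ) * c) : ¬ (k : ℤ) ∣ y := by
  rcases hk with rfl | rfl <;> push_cast at * <;> omega

/-- Along the strip the multiples of `k` are the two corner columns. -/
theorem dvd_cases_along {k : ℕ} (hk : k = 2 ∨ k = 3) {c x : ℤ} (h1 : (k : ℤ) * c - 1 ≤ x)
    (h2 : x ≤ (k : ℤ) * c + (k : ℤ) + 1) (h3 : (k : ℤ) ∣ x) : x = (k : ℤ) * c ∨ x = (k : ℤ) * c + k := by
  rcases hk with rfl | rfl <;> push_cast at * <;> omega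

/-- Next to a multiple of `k` there is no multiple of `k`. -/
theorem not_dvd_near {k : ℕ} (hk : k = 2 ∨ k = 3) {x : ℤ} (h : (k : ℤ) ∣ x) :
    ¬ (k : ℤ) ∣ x + 1 ∧ ¬ (k : ℤ) ∣ x - 1 := by
  rcases hk with rfl | rfl <;> push_cast at * <;> omega

/-- **Rerouting lemma on `ℤ²`** (registered form of `openCrossing_reroute`). -/
theorem openCrossing_reroute_site : ∀ (R A B D C : Set (Site 2)) (ω ω' ω'' : BondConfig (Site 2)), ω ∈ openCrossing R A B → (∀ x y : Site 2, s(x, y) ∈ ω → (x ∉ D ∨ y ∉ D) → s(x, y) ∈ ω') → (∀ x ∈ D, x ∉ C → ∀ y : Site 2, s(x, y) ∈ ω → y ≠ x → y ∈ C) → (∀ a ∈ C ∩ R, ∀ a' ∈ C ∩ R, ω'' ∈ openConnIn R a a') → ω' ⊆ ω'' → (∀ x ∈ D ∩ R, x ∈ A → x ∉ C → ∃ a ∈ C ∩ R, a ∈ A) → (∀ x ∈ D ∩ R, x ∈ B → x ∉ C → ∃ a ∈ C ∩ R, a ∈ B) → ω'' ∈ openCrossing R A B :=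
  fun _ _ _ _ _ _ _ _ hω h2 h3 h4 h5 h6A h6B => openCrossing_reroute hω h2 h3 h4 h5 h6A h6B

end Summit.CriticalPhenomena.CardyFormulaZ2.Theorems.CardySelfRefinement

end
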